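import Summits.ResolutionOfSingularities.ResolutionOfSingularities.Theorems.FrobeniusClosingPatchingRelPerfectDepthWeightTwoBNrState
import Summits.ResolutionOfSingularities.ResolutionOfSingularities.Theorems.FrobeniusClosingPatchingRelPerfectDepthWeightTwoBPieceStepOut
import Literature.AlgebraicGeometry.Resolution.StalkIdealLemmas
import HarnessLib

/-!
# Crux `PatchingRelPerfect` (stmt-ResolutionOfSingularities-16161), chain W5.2 — F5c / TargetsF5c T5-E^nr «W₂B WITHOUT REDUCEDNESS»:
# the SINGLE-PIECE STEP, output side, re-keyed on `StateNr` — new state and transport of the centre data of a disjoint piece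

[OURS · L1 W5.2 · TargetsF5c T5-E^nr (res-L1-w52-plan-1 STEER 4 2026-08-27T11:07:07Z; owner res-D-pv-052 AS res-L1-w52-stub-7).]
Fact-free; NOT statements of the manuscript under review (Hironaka 2017); AI-written, weaker than expert review.

This is res-D-pv-054's `…DepthWeightTwoBPieceStepOut` (T5-E, p517812) VERBATIM with the state `WeightTwoB.StateIn` replaced by
`WeightTwoB.StateNr` (= `StateIn` minus `hostRad`, `…DepthWeightTwoBNrState`): every primed lemma (`support_host'`,
`strictTransform_host_eq`, `hostCartier'`, `free_exc`, `free_strict`, `not_host'_le_strict`, `not_host'_le_exc`, `irred'`,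
`free'`, `sub𝒟'`, `fac'`, `joint'`) has the same proof — none of them used reducedness; the state-free lemmas
(`mem_stepExp_iff`, `exists_mem_of_weightAt_pos`, `isPermissible_map_map_of_ringEquiv`, `mem_support_of_mem_support_host'`,
`sncB'`, `stepExp`, `boundaryOf_stepExp`, …) are used BY NAME from the T5-E module.  The two genuine changes:
* `stateNr'` — the new state needs no `hrad` (nothing to re-establish);
* `centreIn_transport` — the CJS permissibility clause of a disjoint piece is transported WITHOUT `hostRad`: the reduced-host
  stalk `(vanishingIdeal (Supp τᶜ(D, m)))_{z'}` off the centre is the radical of `τᶜ(D, m)_{z'} = (D · 𝒪)_{z'}`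
  (`vanishingIdeal_support`, `stalkIdeal_radical`, `stalkIdeal_controlledTransform_of_not_mem`), and radicals commute with the
  stalk isomorphism (`Ideal.map_radical_of_surjective`).
Namespace `WeightTwoB.Nr` (fresh FQNs; short names as in T5-E).

## References
* E. Bierstone, D. Grigoriev, P. Milman, J. Włodarczyk, arXiv:1206.3090, Def. 3.1.3, §3.2, §4 Step 2. [BierstoneGrigorievMilmanWlodarczyk2011]
* V. Cossart, U. Jannsen, S. Saito, LNM 2270 (2020), Def. 3.1, Def. 4.1, (6.2). [CossartJannsenSaito2020]
* U. Görtz, T. Wedhorn, *Algebraic Geometry II* (2023), Prop. 13.91. [GortzWedhorn2020]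
* J. Kollár, *Lectures on Resolution of Singularities* (2007), 3.30.2, 3.104 Step 2. [Kollar2007]
-/

-- `Summit.<Summit>.<Sub>.Theorems` with `Sub = Summit` (single-conjunct summit, D-0017)
set_option linter.dupNamespace false

noncomputable section

open CategoryTheory CategoryTheory.Limits AlgebraicGeometry TopologicalSpace IsLocalRing
open Literature.AlgebraicGeometry.Resolution Scheme.IdealSheafData
open Literature.AlgebraicGeometry.Hironaka2017.S16Proof
open Literature.AlgebraicGeometry.Hironaka2017.MonomialPart Literature.AlgebraicGeometry.Hironaka2017.MonomialComponent

namespace Summit.ResolutionOfSingularities.ResolutionOfSingularities.Theorems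

universe u

namespace WeightTwoB

namespace Nr

open DepthSNC

variable {W : Scheme.{u}}

/-! ## The single-piece step, output side (state `StateNr`) -/

section Step

variable [IsLocallyNoetherian W] {𝔟 D : W.IdealSheafData} {ℬ 𝒟 : List (W.IdealSheafData × ℕ)} {Z : Closeds W} {η : W}
  {W' : Scheme.{u}} {τ : W' ⟶ W} {m : ℕ}

/-- The piece has empty interior (it lies on the hypersurface `Supp D`). [folklore] -/
theorem interior_piece_eq_empty (S : StateNr 𝔟 D ℬ 𝒟) (Γ : CentreIn D ℬ Z) (hη : IsGenericPoint η (Z : Set W)) : interior (Z : Set W) = ∅ := by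
  have P := S.pieceIn Γ hη
  have h := interior_eq_empty_of_isGenericPoint_of_mem_support P.gen' P.hostCartier (P.subZ P.η_mem)
  rwa [PieceIn.support_eq (Z := Z)] at h


/-- The exceptional divisor is irreducible. [cite: GortzWedhorn2020, Prop. 13.91] -/
private theorem isIrreducible_exc (S : StateNr 𝔟 D ℬ 𝒟) (Γ : CentreIn D ℬ Z) (hη : IsGenericPoint η (Z : Set W)) (hτ : IsBlowup τ (vanishingIdeal Z)) : IsIrreducible ((((vanishingIdeal Z).comap τ).support : Set W')) := by
  rw [support_comap, Closeds.coe_preimage, Scheme.IdealSheafData.coe_support_vanishingIdeal]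
  exact IsBlowup.isIrreducible_preimage_of_isRegular S.regW Γ.regZ Γ.irred (interior_piece_eq_empty S Γ hη) hτ


/-- **The support of the transported host**: `Supp τᶜ(D, m) = cl τ⁻¹(Supp D ∖ Z)` (res-D-pv-026's (L-A)).
[cite: BierstoneGrigorievMilmanWlodarczyk2011, §3.2] -/
theorem support_host' (S : StateNr 𝔟 D ℬ 𝒟) (Γ : CentreIn D ℬ Z) (hη : IsGenericPoint η (Z : Set W)) (hτ : IsBlowup τ (vanishingIdeal Z)) (hm : idealOrder D η = m) : ((controlledTransform τ (vanishingIdeal Z) D m).support : Set W') =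
    closure (τ ⁻¹' ((D.support : Set W) \ Z)) := by
  have P := S.pieceIn Γ hη
  rw [hτ.support_controlledTransform_eq_closure_of_mem_support S.regW Γ.regZ P.gen' (P.subZ P.η_mem) hm S.hostCartier,
    Scheme.IdealSheafData.coe_support_vanishingIdeal]

/-- The strict transform of the host is its controlled transform with the generic weight (res-D-pv-026's (L-A)).
[cite: Kollar2007, 3.30.2] -/
private theorem strictTransform_host_eq (S : StateNr 𝔟 D ℬ 𝒟) (Γ : CentreIn D ℬ Z) (hη : IsGenericPoint η (Z : Set W)) (hτ : IsBlowup τ (vanishingIdeal Z)) (hm : idealOrder D η = m) :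
    strictTransformIdeal τ (vanishingIdeal Z) D = controlledTransform τ (vanishingIdeal Z) D m := by
  have P := S.pieceIn Γ hη
  exact hτ.strictTransformIdeal_eq_controlledTransform S.regW Γ.regZ P.gen'
    (by rw [Scheme.IdealSheafData.coe_support_vanishingIdeal]; exact interior_piece_eq_empty S Γ hη) hm S.hostCartier

/-- The transported host is an effective Cartier divisor. [cite: Kollar2007, 3.30.2] -/
private theorem hostCartier' (S : StateNr 𝔟 D ℬ 𝒟) (Γ : CentreIn D ℬ Z) (hη : IsGenericPoint η (Z : Set W)) (hτ : IsBlowup τ (vanishingIdeal Z)) (hm : idealOrder D η = m) : IsEffectiveCartier (controlledTransform τ (vanishingIdeal Z) D m) :=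
  hτ.isEffectiveCartier_controlledTransform_of_le_pow S.hostCartier ((S.pieceIn Γ hη).host_le_pow hm)

/-- **SUPPORT form of «the transported host is not the exceptional divisor»**: `τ⁻¹Z ⊄ Supp τᶜ(D, m)` — at the generic point of
the (irreducible, reduced) exceptional divisor the exceptional ideal is the maximal ideal, which does not contain the stalk of
`τᶜ(D, m)` by (L-A). [cite: Kollar2007, 3.30.2] -/
private theorem free_exc (S : StateNr 𝔟 D ℬ 𝒟) (Γ : CentreIn D ℬ Z) (hη : IsGenericPoint η (Z : Set W)) (hτ : IsBlowup τ (vanishingIdeal Z)) (hm : idealOrder D η = m) : ¬ ((((vanishingIdeal Z).comap τ).support : Set W') ⊆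
    (controlledTransform τ (vanishingIdeal Z) D m).support) := by
  haveI : IsLocallyNoetherian W' := hτ.isLocallyNoetherian
  intro hsub
  set G := (vanishingIdeal Z).comap τ with hG
  obtain ⟨ξ, hξ⟩ := QuasiSober.sober (isIrreducible_exc S Γ hη hτ) G.support.isClosed
  have hξG : ξ ∈ (G.support : Set W') := hξ.mem
  -- the exceptional ideal is reduced (a member of the snc family of the transform), so its stalk at `ξ` is `𝔪_ξ`
  have hGrad : vanishingIdeal G.support = G :=
    (Γ.sncZ.hasSNC_transform hτ).vanishingIdeal_support (List.mem_append_right _ (List.mem_singleton_self _))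
  have hGξ : stalkIdeal G ξ = maximalIdeal (W'.presheaf.stalk ξ) := by
    have hcl : G.support = ⟨closure {ξ}, isClosed_closure⟩ := Closeds.ext hξ.symm
    rw [← hGrad, hcl, stalkIdeal_vanishingIdeal_closure (specializes_refl ξ), primeOfSpecializes_refl]
  -- `ξ ∈ Supp τᶜ(D, m)` would put its stalk inside `𝔪_ξ = G_ξ`
  have hξD : stalkIdeal (controlledTransform τ (vanishingIdeal Z) D m) ξ ≤ stalkIdeal G ξ := by
    rw [hGξ]; exact (mem_support_iff_stalkIdeal_le _ ξ).mp (hsub hξG)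
  have hτξ : τ ξ ∈ (Z : Set W) := by
    have h := (mem_support_comap_iff τ (vanishingIdeal Z) ξ).mp hξG
    rwa [Scheme.IdealSheafData.coe_support_vanishingIdeal] at h
  exact hτ.not_stalkIdeal_controlledTransform_le_of_idealOrder_genericPoint_eq S.regW Γ.regZ hη
    (interior_piece_eq_empty S Γ hη) hm hτξ hξD

/-- **SUPPORT form of «the transported host contains no strict transform of a member»**: `Supp 𝓘(B') ⊄ Supp τᶜ(D, m)` for every
member `B` — off `Z` the blow-up is an isomorphism and `Supp B ⊄ Supp D`. [cite: Kollar2007, 3.30.2] -/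
private theorem free_strict (S : StateNr 𝔟 D ℬ 𝒟) (Γ : CentreIn D ℬ Z) (hτ : IsBlowup τ (vanishingIdeal Z)) (p : W.IdealSheafData × ℕ) (hp : p ∈ ℬ) :
    ¬ (((strictTransformIdeal τ (vanishingIdeal Z) p.1).support : Set W') ⊆
      (controlledTransform τ (vanishingIdeal Z) D m).support) := by
  haveI : IsLocallyNoetherian W' := hτ.isLocallyNoetherian
  intro hsub
  refine S.free p hp fun y hy => ?_
  by_cases hyZ : y ∈ (Z : Set W)
  · exact Γ.subZ hyZ
  · have hyC : y ∉ ((vanishingIdeal Z).support : Set W) := by rwa [Scheme.IdealSheafData.coe_support_vanishingIdeal]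
    obtain ⟨y', rfl⟩ := hτ.exists_eq_of_not_mem_support hyC
    have hy'E : y' ∉ ((vanishingIdeal Z).comap τ).support := fun h =>
      hyC ((mem_support_comap_iff τ (vanishingIdeal Z) y').mp h)
    have hy'B : y' ∈ (strictTransformIdeal τ (vanishingIdeal Z) p.1).support :=
      (mem_support_strictTransformIdeal_iff_of_not_mem_exceptional τ (vanishingIdeal Z) p.1 hy'E).mpr hy
    exact mem_support_of_mem_support_host' (hsub hy'B)

/-- The cons clause: `τᶜ(D, m) ⊄ 𝓘(B')` for every strict transform of a member. [cite: Kollar2007, 3.30.2] -/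
theorem not_host'_le_strict (S : StateNr 𝔟 D ℬ 𝒟) (Γ : CentreIn D ℬ Z) (hτ : IsBlowup τ (vanishingIdeal Z)) (p : W.IdealSheafData × ℕ) (hp : p ∈ ℬ) :
    ¬ controlledTransform τ (vanishingIdeal Z) D m ≤ strictTransformIdeal τ (vanishingIdeal Z) p.1 := fun h =>
  free_strict S Γ hτ p hp (support_antitone h)

/-- The cons clause: `τᶜ(D, m) ⊄ C𝒪`. [cite: Kollar2007, 3.30.2] -/
theorem not_host'_le_exc (S : StateNr 𝔟 D ℬ 𝒟) (Γ : CentreIn D ℬ Z) (hη : IsGenericPoint η (Z : Set W)) (hτ : IsBlowup τ (vanishingIdeal Z)) (hm : idealOrder D η = m) : ¬ controlledTransform τ (vanishingIdeal Z) D m ≤ (vanishingIdeal Z).comap τ := fun h =>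
  free_exc S Γ hη hτ hm (support_antitone h)

/-- The new boundary sheaves have irreducible supports. [cite: GortzWedhorn2020, Prop. 13.91] -/
private theorem irred' (S : StateNr 𝔟 D ℬ 𝒟) (Γ : CentreIn D ℬ Z) (hη : IsGenericPoint η (Z : Set W)) (hτ : IsBlowup τ (vanishingIdeal Z)) (e : ℕ) : ∀ p ∈ stepExp ℬ τ (vanishingIdeal Z) e, IsIrreducible (p.1.support : Set W') := by
  haveI : IsLocallyNoetherian W' := hτ.isLocallyNoetherian
  intro p hp
  rcases mem_stepExp_iff.mp hp with ⟨q, hq, rfl⟩ | rfl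
  · refine isIrreducible_support_strictTransformIdeal hτ q.1 (S.irred q hq) ?_
    rw [Scheme.IdealSheafData.coe_support_vanishingIdeal]
    exact fun h => S.free _ hq (h.trans Γ.subZ)
  · exact isIrreducible_exc S Γ hη hτ

/-- No new boundary sheaf has its support inside the transported host. [cite: Kollar2007, 3.30.2] -/
private theorem free' (S : StateNr 𝔟 D ℬ 𝒟) (Γ : CentreIn D ℬ Z) (hη : IsGenericPoint η (Z : Set W)) (hτ : IsBlowup τ (vanishingIdeal Z)) (hm : idealOrder D η = m) (e : ℕ) : ∀ p ∈ stepExp ℬ τ (vanishingIdeal Z) e,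
    ¬ ((p.1.support : Set W') ⊆ (controlledTransform τ (vanishingIdeal Z) D m).support) := by
  intro p hp
  rcases mem_stepExp_iff.mp hp with ⟨q, hq, rfl⟩ | rfl
  · exact free_strict S Γ hτ q hq
  · exact free_exc S Γ hη hτ hm

/-- The transported N-exponent list lives on the new boundary sheaves. [folklore] -/
private theorem sub𝒟' (S : StateNr 𝔟 D ℬ 𝒟) (e e' : ℕ) : ∀ p ∈ stepExp 𝒟 τ (vanishingIdeal Z) e', p.1 ∈ boundaryOf (stepExp ℬ τ (vanishingIdeal Z) e) := by
  intro p hp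
  rw [boundaryOf_stepExp]
  rcases mem_stepExp_iff.mp hp with ⟨q, hq, rfl⟩ | rfl
  · exact List.mem_append_left _ (List.mem_map.mpr ⟨q.1, S.sub𝒟 q hq, rfl⟩)
  · exact List.mem_append_right _ (List.mem_singleton_self _)

/-- **The new factorisation** `τᶜ(𝔟, ν) = τᶜ(D, m) · monomialIdeal ℬ'`, `ℬ' = strict transforms ++ [(C𝒪, m + w − ν)]`.
[cite: BierstoneGrigorievMilmanWlodarczyk2011, §4 Step 2a] [cite: Kollar2007, (3.111) Step 1] -/
private theorem fac' (S : StateNr 𝔟 D ℬ 𝒟) (Γ : CentreIn D ℬ Z) (hη : IsGenericPoint η (Z : Set W)) (hτ : IsBlowup τ (vanishingIdeal Z)) (hm : idealOrder D η = m) : controlledTransform τ (vanishingIdeal Z) 𝔟 (pieceWeight 𝔟 (Z : Set W)) =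
    controlledTransform τ (vanishingIdeal Z) D m *
      monomialIdeal (stepExp ℬ τ (vanishingIdeal Z)
        (m + weightOf ℬ (divisorsOver ℬ (vanishingIdeal Z) (vanishingIdeal Z).support) - pieceWeight 𝔟 (Z : Set W))) := by
  have P := S.pieceIn Γ hη
  obtain ⟨m₀, hm₀, hm1⟩ := P.exists_idealOrder_host_eq
  obtain rfl : m = m₀ := by have := hm.symm.trans hm₀; exact_mod_cast this
  set ν := pieceWeight 𝔟 (Z : Set W)
  have h1 := hτ.comap_eq_pow_mul_controlledTransform_of_le_pow P.le_pow_weight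
  have hν : ν ≤ m + weightAt ℬ η := by
    have h := P.weight_le_add hm hm1
    rwa [weightOf_divisorsOver_single_eq_weightAt ℬ hη] at h
  have h2 := comap_host_mul_monomialIdeal hη Γ.sncZ hτ (hτ.comap_eq_pow_mul_controlledTransform_of_le_pow (P.host_le_pow hm)) hν
  rw [← S.fac, h1, ← weightOf_divisorsOver_single_eq_weightAt ℬ hη] at h2
  exact (hτ.isEffectiveCartier.pow ν).eq_of_mul_eq_mul h2

/-- **The JOINT invariant (J#) on the blown-up scheme.** [cite: Kollar2007, 3.104 Step 2.1, Def. 3.25] -/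
theorem joint' (S : StateNr 𝔟 D ℬ 𝒟) (Γ : CentreIn D ℬ Z) (hη : IsGenericPoint η (Z : Set W)) (hτ : IsBlowup τ (vanishingIdeal Z)) (hm : idealOrder D η = m) (e : ℕ) :
    ∀ x' ∈ (controlledTransform τ (vanishingIdeal Z) D m).support,
      (∃ p ∈ stepExp 𝒟 τ (vanishingIdeal Z)
          (weightOf 𝒟 (divisorsOver 𝒟 (vanishingIdeal Z) (vanishingIdeal Z).support) + (2 - pieceWeight 𝔟 (Z : Set W))),
        0 < p.2 ∧ x' ∈ p.1.support) →
      SNCWithAt (controlledTransform τ (vanishingIdeal Z) D m ::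
        charged (stepExp ℬ τ (vanishingIdeal Z) e)
          (stepExp 𝒟 τ (vanishingIdeal Z)
            (weightOf 𝒟 (divisorsOver 𝒟 (vanishingIdeal Z) (vanishingIdeal Z).support) + (2 - pieceWeight 𝔟 (Z : Set W)))))
        ⊤ x' := by
  haveI : IsLocallyNoetherian W' := hτ.isLocallyNoetherian
  have P := S.pieceIn Γ hη
  intro x' hx' hN
  have hzD : τ x' ∈ D.support := mem_support_of_mem_support_host' hx'
  -- Step 1: the JOINT clause WITH the centre holds at `τ x'`
  have hE : SNCWithAt (D :: charged ℬ 𝒟) (vanishingIdeal Z) (τ x') := by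
    by_cases hz : τ x' ∈ (Z : Set W)
    · refine (P.joint_clause hz ?_).2
      obtain ⟨p, hp, hp0, hxp⟩ := hN
      rcases mem_stepExp_iff.mp hp with ⟨q, hq, rfl⟩ | rfl
      · -- a strict transform of an N-charged member through `x'`
        refine Or.inr ⟨q, hq, hp0, ?_⟩
        have h := support_antitone ((comap_le_controlledTransform τ (vanishingIdeal Z) q.1 0).trans
          (controlledTransform_le_strictTransformIdeal τ (vanishingIdeal Z) q.1 0)) hxp
        exact (mem_support_comap_iff τ q.1 x').mp h
      · -- the exceptional member is N-charged: weight-deficient step or `Z` inside an N-charged member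
        by_cases hν : pieceWeight 𝔟 (Z : Set W) < 2
        · exact Or.inl hν
        · have hw : 0 < weightAt 𝒟 η := by
            rw [← weightOf_divisorsOver_single_eq_weightAt 𝒟 hη]
            simp only at hp0; omega
          obtain ⟨q, hq, hq0, hηq⟩ := exists_mem_of_weightAt_pos hw
          exact Or.inr ⟨q, hq, hq0, (hη.specializes hz).mem_closed q.1.support.isClosed hηq⟩
    · have hzC : τ x' ∉ ((vanishingIdeal Z).support : Set W) := by rwa [Scheme.IdealSheafData.coe_support_vanishingIdeal]
      refine (S.joint _ hzD ?_).of_not_mem_support hzC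
      obtain ⟨p, hp, hp0, hxp⟩ := hN
      rcases mem_stepExp_iff.mp hp with ⟨q, hq, rfl⟩ | rfl
      · refine ⟨q, hq, hp0, ?_⟩
        have h := support_antitone ((comap_le_controlledTransform τ (vanishingIdeal Z) q.1 0).trans
          (controlledTransform_le_strictTransformIdeal τ (vanishingIdeal Z) q.1 0)) hxp
        exact (mem_support_comap_iff τ q.1 x').mp h
      · exact absurd ((mem_support_comap_iff τ (vanishingIdeal Z) x').mp hxp) hzC
  -- Step 2: transport, and read the host's strict transform as the controlled transform
  have hT := hτ.sncWithAt_transform x' hE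
  rw [List.map_cons, List.cons_append, strictTransform_host_eq S Γ hη hτ hm] at hT
  -- Step 3: the charged members of the new lists are among the transported charged members
  refine hT.anti fun B hB _ => ?_
  rcases List.mem_cons.mp hB with rfl | hB
  · exact List.mem_cons_self
  · refine List.mem_cons_of_mem _ ?_
    obtain ⟨c, hc, h𝒟' | hℬ'⟩ := mem_charged_iff.mp hB
    · rcases mem_stepExp_iff.mp h𝒟' with ⟨q, hq, hBq⟩ | hBq
      · cases hBq
        exact List.mem_append_left _ (List.mem_map.mpr ⟨q.1, mem_charged_iff.mpr ⟨q.2, hc, Or.inl hq⟩, rfl⟩)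
      · cases hBq
        exact List.mem_append_right _ (List.mem_singleton_self _)
    · rcases mem_stepExp_iff.mp hℬ' with ⟨q, hq, hBq⟩ | hBq
      · cases hBq
        exact List.mem_append_left _ (List.mem_map.mpr ⟨q.1, mem_charged_iff.mpr ⟨q.2, hc, Or.inr hq⟩, rfl⟩)
      · cases hBq
        exact List.mem_append_right _ (List.mem_singleton_self _)

/-- **The new state** (T5-E^nr: no reducedness to re-establish). [cite: BierstoneGrigorievMilmanWlodarczyk2011, Def. 3.1.3]
[cite: Kollar2007, 3.30.2] -/
theorem stateNr' (S : StateNr 𝔟 D ℬ 𝒟) (Γ : CentreIn D ℬ Z) (hη : IsGenericPoint η (Z : Set W)) (hτ : IsBlowup τ (vanishingIdeal Z)) (hm : idealOrder D η = m) :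
    @StateNr W' hτ.isLocallyNoetherian (controlledTransform τ (vanishingIdeal Z) 𝔟 (pieceWeight 𝔟 (Z : Set W)))
      (controlledTransform τ (vanishingIdeal Z) D m)
      (stepExp ℬ τ (vanishingIdeal Z)
        (m + weightOf ℬ (divisorsOver ℬ (vanishingIdeal Z) (vanishingIdeal Z).support) - pieceWeight 𝔟 (Z : Set W)))
      (stepExp 𝒟 τ (vanishingIdeal Z)
        (weightOf 𝒟 (divisorsOver 𝒟 (vanishingIdeal Z) (vanishingIdeal Z).support) + (2 - pieceWeight 𝔟 (Z : Set W)))) := by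
  haveI : IsLocallyNoetherian W' := hτ.isLocallyNoetherian
  exact { regW := hτ.isRegular_of_isRegular_subscheme S.regW Γ.regZ
          fac := fac' S Γ hη hτ hm
          hostCartier := hostCartier' S Γ hη hτ hm
          sncB := sncB' Γ hτ _
          irred := irred' S Γ hη hτ _
          free := free' S Γ hη hτ hm _
          sub𝒟 := sub𝒟' S _ _
          joint := joint' S Γ hη hτ hm _ }

/-! ## Transport of the centre data of a disjoint piece -/

/-- **The centre data of a DISJOINT piece survive the blow-up** (as data for the transported host and boundary on `τ⁻¹Z₂`;
reducedness-free, so no state is needed). [cite: BierstoneGrigorievMilmanWlodarczyk2011, §4 Step 2b] [cite: GortzWedhorn2020, Prop. 13.91 (3)] -/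
theorem centreIn_transport (Γ : CentreIn D ℬ Z) (hτ : IsBlowup τ (vanishingIdeal Z))
    {Z₂ : Closeds W} (Γ₂ : CentreIn D ℬ Z₂) (hd : Disjoint (Z : Set W) Z₂) (e : ℕ) :
    @CentreIn W' hτ.isLocallyNoetherian (controlledTransform τ (vanishingIdeal Z) D m) (stepExp ℬ τ (vanishingIdeal Z) e)
      (Z₂.preimage τ.continuous) := by
  haveI : IsLocallyNoetherian W' := hτ.isLocallyNoetherian
  have hd' : Disjoint (Z₂ : Set W) ((vanishingIdeal Z).support : Set W) := by
    rw [Scheme.IdealSheafData.coe_support_vanishingIdeal]; exact hd.symm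
  have hdC : Disjoint ((vanishingIdeal Z).support : Set W) ((vanishingIdeal Z₂).support : Set W) := by
    rw [Scheme.IdealSheafData.coe_support_vanishingIdeal, Scheme.IdealSheafData.coe_support_vanishingIdeal]; exact hd
  have hcomap : (vanishingIdeal Z₂).comap τ = vanishingIdeal (Z₂.preimage τ.continuous) :=
    hτ.comap_vanishingIdeal_of_disjoint Z₂ hd'
  refine { irred := ?_, regZ := ?_, subZ := ?_, sncZ := ?_, perm := ?_ }
  · exact hτ.isIrreducible_preimage_of_disjoint Z₂ hd' Γ₂.irred
  · exact hτ.isRegular_subscheme_vanishingIdeal_preimage Z₂ hd' Γ₂.regZ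
  · intro y' hy'
    have hy : τ y' ∈ (Z₂ : Set W) := hy'
    refine hτ.closure_preimage_diff_subset_support_controlledTransform m (subset_closure ⟨Γ₂.subZ hy, ?_⟩)
    rw [Scheme.IdealSheafData.coe_support_vanishingIdeal]
    exact Set.disjoint_right.mp hd hy
  · have h := HasSNCWith.transform_comap_of_disjoint hτ Γ.sncZ Γ₂.sncZ hdC
    rwa [← boundaryOf_stepExp ℬ τ (vanishingIdeal Z) e, hcomap] at h
  · intro z' hz'
    have hz : τ z' ∈ (Z₂ : Set W) := hz'
    have hzC : τ z' ∉ ((vanishingIdeal Z).support : Set W) := by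
      rw [Scheme.IdealSheafData.coe_support_vanishingIdeal]; exact Set.disjoint_right.mp hd hz
    haveI := hτ.isIso_stalkMap_of_not_mem_support hzC
    let eqv : W.presheaf.stalk (τ z') ≃+* W'.presheaf.stalk z' := (asIso (τ.stalkMap z')).commRingCatIsoToRingEquiv
    have heqv : (eqv : W.presheaf.stalk (τ z') →+* W'.presheaf.stalk z') = (τ.stalkMap z').hom := rfl
    -- the centre stalk and the REDUCED-host stalk (radicals commute with stalks and with the stalk isomorphism), read
    -- through the stalk isomorphism — the one place where T5-E used `hostRad`, replaced by `vanishingIdeal_support`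
    have hI : stalkIdeal (vanishingIdeal (Z₂.preimage τ.continuous)) z' =
        (stalkIdeal (vanishingIdeal Z₂) (τ z')).map (eqv : W.presheaf.stalk (τ z') →+* W'.presheaf.stalk z') := by
      rw [← hcomap, stalkIdeal_comap_eq_map, heqv]
    have hJ : stalkIdeal (vanishingIdeal (controlledTransform τ (vanishingIdeal Z) D m).support) z' =
        (stalkIdeal (vanishingIdeal D.support) (τ z')).map (eqv : W.presheaf.stalk (τ z') →+* W'.presheaf.stalk z') := by
      rw [Scheme.IdealSheafData.vanishingIdeal_support, Scheme.IdealSheafData.vanishingIdeal_support, stalkIdeal_radical,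
        stalkIdeal_radical, hτ.stalkIdeal_controlledTransform_of_not_mem D m hzC, stalkIdeal_comap_eq_map, heqv]
      have hbij := ConcreteCategory.bijective_of_isIso (τ.stalkMap z')
      exact (Ideal.map_radical_of_surjective hbij.2
        (by rw [(RingHom.injective_iff_ker_eq_bot _).mp hbij.1]; exact bot_le)).symm
    rw [hI, hJ]
    exact isPermissible_map_map_of_ringEquiv eqv (Γ₂.perm (τ z') hz)

end Step

end Nr

end WeightTwoB

end Summit.ResolutionOfSingularities.ResolutionOfSingularities.Theorems

end
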